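import Literature.Combinatorics.SetFamily.SpreadLemmaProofs
import Literature.Computability.Complexity.MonotoneClosure
import HarnessLib

/-!
# Closed monotone functions have few minterms (Cavalar–Kumar–Rossman, Lemma 2.11)

**CKR Lemma 2.11**: if an up-set `𝒯 ⊆ 𝒫(V)` is closed (`IsClosedFam c ε 𝒯`, CKR Def. 2.6, for
the uniform negative input and `ε ∈ (0, 1/2]`), then for every `1 ≤ ℓ ≤ c` it has at most
`(2 B log(ℓ/ε))^ℓ` minterms of size `ℓ`, where `B = spreadConst` is the constant of the spread
lemma (`Literature.Combinatorics.SetFamily.spread_lemma`; CKR Thm. 1.3/6.1 with `p = 1/2`):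
a larger family of `ℓ`-minterms contains, after fixing a maximiser `T₀` of `|F_T| r^{|T|}`
(the reduction of CKR §6, proof of Thm. 1.3, Case 1), an `r`-spread link `{S \ T₀}` which the
uniform input hits with probability `> 1 - ε`, forcing `T₀ ∈ 𝒯` by closedness and contradicting
the minimality of the minterms through `T₀`.

* `prHalf_eq_sum_biasedWeight` — the uniform input is `μ_{1/2}` (bridge to `BiasedMeasure`);
* `card_minimals_filter_card_eq_le` — CKR Lemma 2.11.

## References

* B. P. Cavalar, M. Kumar, B. Rossman, *Monotone circuit lower bounds from robust sunflowers*,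
  Algorithmica 84 (2022), Lemma 2.11, Thm. 1.3 and §6 [CavalarKumarRossman2022].
* T. Bell, *The Park–Pham theorem with optimal convergence rate*, Electron. J. Combin. 30(2)
  (2023), Thm. 3 [Bell2023].
-/

namespace Literature.Computability.Complexity.CKR

open Finset Razborov Literature.Combinatorics.SetFamily

variable {V : Type*} [Fintype V] [DecidableEq V]

omit [DecidableEq V] in
/-- The uniform input is the `1/2`-biased one: `μ_{1/2}(W) = 2^{-|V|}`. [folklore] -/
theorem biasedWeight_half (W : Finset V) : biasedWeight (1 / 2) W = 1 / 2 ^ Fintype.card V := by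
  unfold biasedWeight
  rw [show (1 : ℝ) - 1 / 2 = 1 / 2 by norm_num, ← pow_add, Nat.add_sub_cancel' (card_le_univ W),
    one_div_pow]

omit [DecidableEq V] in
/-- `prHalf` is the `μ_{1/2}`-probability of `BiasedMeasure.lean`. [folklore] -/
theorem prHalf_eq_sum_biasedWeight (E : Finset V → Prop) [DecidablePred E] :
    prHalf E = ∑ W ∈ univ.filter E, biasedWeight (1 / 2) W := by
  simp_rw [biasedWeight_half]
  rw [sum_const, nsmul_eq_mul, prHalf, mul_one_div]

/-- **CKR Lemma 2.11 (closed functions have few minterms)**: a closed up-set has at most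
`(2 B log(ℓ/ε))^ℓ` minterms of size `ℓ`, for `1 ≤ ℓ ≤ c` and `0 < ε ≤ 1/2`, where `B` is the
spread-lemma constant (the printed bound `(B log(ℓ/ε)/p)^ℓ` at `p = 1/2`; CKR then estimate
`≤ (6 B c log n)^ℓ` for `ε = n^{-2c}`). [cite: CavalarKumarRossman2022, Lemma 2.11] -/
theorem card_minimals_filter_card_eq_le {c : ℕ} {ε : ℝ} {𝒯 : Finset (Finset V)}
    (hup : IsUpperSet (𝒯 : Set (Finset V))) (hcl : IsClosedFam c ε 𝒯) (hε0 : 0 < ε)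
    (hε1 : ε ≤ 1 / 2) {ℓ : ℕ} (hℓ1 : 1 ≤ ℓ) (hℓc : ℓ ≤ c) :
    (#((minimals 𝒯).filter fun A => #A = ℓ) : ℝ) ≤ (2 * spreadConst * Real.log (ℓ / ε)) ^ ℓ := by
  set r : ℝ := 2 * spreadConst * Real.log (ℓ / ε) with hr
  set F : Finset (Finset V) := (minimals 𝒯).filter fun A => #A = ℓ with hF
  -- positivity of `r`
  have hlog : 0 < Real.log (ℓ / ε) := by
    apply Real.log_pos
    rw [lt_div_iff₀ hε0]
    have : (1 : ℝ) ≤ ℓ := by exact_mod_cast hℓ1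
    linarith
  have hr0 : 0 < r := by have := spreadConst_pos; positivity
  by_contra hcon
  rw [not_le] at hcon
  -- members of `F`
  have hFmem : ∀ S ∈ F, S ∈ minimals 𝒯 ∧ #S = ℓ := fun S hS => mem_filter.1 hS
  -- the weight `g(T) = |F_T| r^{|T|}` and a maximiser `T₀` among the sets of size `≤ ℓ`
  set g : Finset V → ℝ := fun T => #(F.filter fun S => T ⊆ S) * r ^ #T with hg
  obtain ⟨T₀, hT₀, hmax⟩ := exists_max_image (univ.filter fun T : Finset V => #T ≤ ℓ) g
    ⟨∅, mem_filter.2 ⟨mem_univ _, by simp⟩⟩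
  have hT₀ℓ : #T₀ ≤ ℓ := (mem_filter.1 hT₀).2
  have hg0 : g ∅ = #F := by
    have hfe : (F.filter fun S => (∅ : Finset V) ⊆ S) = F := filter_true_of_mem fun S _ => empty_subset S
    simp only [hg, hfe, card_empty, pow_zero, mul_one]
  have hgT₀ : (#F : ℝ) ≤ g T₀ := hg0 ▸ hmax ∅ (mem_filter.2 ⟨mem_univ _, by simp⟩)
  set m : ℕ := #(F.filter fun S => T₀ ⊆ S) with hm
  have hgT₀' : g T₀ = m * r ^ #T₀ := rfl
  -- `|T₀| < ℓ`
  have hT₀lt : #T₀ < ℓ := by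
    by_contra hge
    have heq : #T₀ = ℓ := le_antisymm hT₀ℓ (not_lt.1 hge)
    have hsub : (F.filter fun S => T₀ ⊆ S) ⊆ {T₀} := by
      intro S hS
      obtain ⟨hSF, hTS⟩ := mem_filter.1 hS
      rw [mem_singleton]
      exact (eq_of_subset_of_card_le hTS (by rw [(hFmem S hSF).2, heq])).symm
    have hm1 : (m : ℝ) ≤ 1 := by exact_mod_cast (card_le_card hsub).trans (card_singleton T₀).le
    have : g T₀ ≤ r ^ ℓ := by
      rw [hgT₀', heq]
      exact mul_le_of_le_one_left (by positivity) hm1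
    linarith
  -- `F_{T₀}` is nonempty
  have hmpos : 0 < m := by
    have h1 : (0 : ℝ) < g T₀ := lt_of_lt_of_le (lt_trans (by positivity) hcon) hgT₀
    rw [hgT₀'] at h1
    have h2 : (0 : ℝ) < m := pos_of_mul_pos_left h1 (by positivity)
    exact_mod_cast h2
  -- the link `G = {S \ T₀ : S ∈ F, T₀ ⊆ S}`
  set G : Finset (Finset V) := (F.filter fun S => T₀ ⊆ S).image fun S => S \ T₀ with hG
  have hGcard : #G = m := by
    rw [hG, card_image_of_injOn]
    intro S hS S' hS' h
    have hTS : T₀ ⊆ S := (mem_filter.1 hS).2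
    have hTS' : T₀ ⊆ S' := (mem_filter.1 hS').2
    change S \ T₀ = S' \ T₀ at h
    rw [← sdiff_union_of_subset hTS, ← sdiff_union_of_subset hTS', h]
  have hGne : G.Nonempty := by
    rw [← card_pos, hGcard]; exact hmpos
  have hGbdd : ∀ S' ∈ G, #S' ≤ ℓ := by
    intro S' hS'
    obtain ⟨S, hS, rfl⟩ := mem_image.1 hS'
    exact (card_le_card sdiff_subset).trans (hFmem S (mem_filter.1 hS).1).2.le
  -- `G` is `r`-spread, by the maximality of `T₀`
  have hGsp : IsSpread r G := by
    intro Z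
    rw [hGcard]
    -- members of `G` containing `Z` come from members of `F` containing `T₀ ∪ Z`
    have hle : #(G.filter fun S' => Z ⊆ S') ≤ #(F.filter fun S => T₀ ∪ Z ⊆ S) := by
      have : (G.filter fun S' => Z ⊆ S') ⊆ (F.filter fun S => T₀ ∪ Z ⊆ S).image fun S => S \ T₀ := by
        intro S' hS'
        obtain ⟨hS'G, hZS'⟩ := mem_filter.1 hS'
        obtain ⟨S, hS, rfl⟩ := mem_image.1 hS'G
        obtain ⟨hSF, hTS⟩ := mem_filter.1 hS
        exact mem_image.2 ⟨S, mem_filter.2 ⟨hSF, union_subset hTS (hZS'.trans sdiff_subset)⟩, rfl⟩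
      exact (card_le_card this).trans card_image_le
    by_cases hdisj : Disjoint T₀ Z
    · by_cases hsize : #(T₀ ∪ Z) ≤ ℓ
      · -- maximality
        have hmx := hmax (T₀ ∪ Z) (mem_filter.2 ⟨mem_univ _, hsize⟩)
        simp only [hg] at hmx
        rw [card_union_of_disjoint hdisj, pow_add] at hmx
        have hrZ : 0 < r ^ #Z := by positivity
        have hrT : 0 < r ^ #T₀ := by positivity
        rw [le_div_iff₀ hrZ]
        calc (#(G.filter fun S' => Z ⊆ S') : ℝ) * r ^ #Z
            ≤ #(F.filter fun S => T₀ ∪ Z ⊆ S) * r ^ #Z := by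
              exact mul_le_mul_of_nonneg_right (by exact_mod_cast hle) hrZ.le
          _ ≤ m := by
              have : (#(F.filter fun S => T₀ ∪ Z ⊆ S) : ℝ) * r ^ #Z * r ^ #T₀ ≤ m * r ^ #T₀ := by
                calc (#(F.filter fun S => T₀ ∪ Z ⊆ S) : ℝ) * r ^ #Z * r ^ #T₀
                    = #(F.filter fun S => T₀ ∪ Z ⊆ S) * (r ^ #T₀ * r ^ #Z) := by ring
                  _ ≤ m * r ^ #T₀ := hmx
              exact le_of_mul_le_mul_right this hrT
      · -- no `ℓ`-set contains `T₀ ∪ Z`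
        have h0 : #(F.filter fun S => T₀ ∪ Z ⊆ S) = 0 := by
          rw [card_eq_zero, filter_eq_empty_iff]
          intro S hS hsub
          have := card_le_card hsub
          rw [(hFmem S hS).2] at this
          exact hsize this
        rw [h0] at hle
        have : (#(G.filter fun S' => Z ⊆ S') : ℝ) = 0 := by exact_mod_cast Nat.le_zero.1 hle
        rw [this]
        positivity
    · -- `Z` meets `T₀`: no member of `G` contains `Z`
      have h0 : #(G.filter fun S' => Z ⊆ S') = 0 := by
        rw [card_eq_zero, filter_eq_empty_iff]
        intro S' hS' hZS'
        obtain ⟨S, -, rfl⟩ := mem_image.1 hS'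
        apply hdisj
        rw [disjoint_iff_ne]
        rintro x hxT _ hxZ rfl
        exact (mem_sdiff.1 (hZS' hxZ)).2 hxT
      rw [h0, Nat.cast_zero]
      positivity
  -- the spread lemma at `p = 1/2`
  have hsp' : IsSpread (spreadConst * Real.log (ℓ / ε) / (1 / 2)) G := by
    rw [show spreadConst * Real.log (ℓ / ε) / (1 / 2) = r by rw [hr]; ring]
    exact hGsp
  have hhit := spread_lemma_spreadConst G ℓ (1 / 2) ε hℓ1 (by norm_num) le_rfl hε0 hε1 hGne hGbdd hsp'
  rw [← prHalf_eq_sum_biasedWeight] at hhit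
  -- hitting `G` makes `T₀ ∪ 𝐍 ∈ 𝒯`
  have hmono : prHalf (fun W : Finset V => ∃ S' ∈ G, S' ⊆ W) ≤ prHalf (fun W : Finset V => T₀ ∪ W ∈ 𝒯) := by
    refine prHalf_mono fun W ⟨S', hS'G, hS'W⟩ => ?_
    obtain ⟨S, hS, rfl⟩ := mem_image.1 hS'G
    obtain ⟨hSF, hTS⟩ := mem_filter.1 hS
    have hS𝒯 : S ∈ 𝒯 := minimals_subset _ (hFmem S hSF).1
    have hsub : S ⊆ T₀ ∪ W := by
      intro x hx
      by_cases hxT : x ∈ T₀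
      · exact mem_union_left _ hxT
      · exact mem_union_right _ (hS'W (mem_sdiff.2 ⟨hx, hxT⟩))
    exact hup hsub hS𝒯
  have hT₀𝒯 : T₀ ∈ 𝒯 := hcl T₀ (by omega) (hhit.trans_le hmono)
  -- contradiction with the minimality of a member of `F` through `T₀`
  obtain ⟨S, hS⟩ := card_pos.1 hmpos
  obtain ⟨hSF, hTS⟩ := mem_filter.1 hS
  obtain ⟨hSmin, hSℓ⟩ := hFmem S hSF
  have hTS' : T₀ = S := (mem_minimals.1 hSmin).2 T₀ hT₀𝒯 hTS
  rw [hTS', hSℓ] at hT₀lt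
  exact lt_irrefl _ hT₀lt

end Literature.Computability.Complexity.CKR
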